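/-
Copyright: the b2b-balaban T⁴-continuum CRUX team, row NE7b OWNER lineage `t4-ne7b-p1` (gen 131). Project licence.
-/
import Summits.QuantumFields.BalabanUV.T4Continuum.Spine.NE7b.SupPolymerLocalSmallness
import Summits.QuantumFields.BalabanUV.T4Continuum.Spine.NE7b.SupRegulatedActivityBound

/-!
# THE ACTIVITY LETTER OF THE POLYMER-LOCAL GAS FROM FACTOR LETTERS: for a family `𝒜 = 𝒜₁ ⊔ 𝒜₂` of cell sets whose members in `𝒜₁` are
# PAIRWISE DISJOINT with REGULATED factors `‖f_X(ω)‖ ≤ ε^{#X}e^{½κΣ_{x∈cells X}ω_x²}` (e.g. the singletons, carrying the road's one-site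
# Mayer factors) and whose members in `𝒜₂` carry SUP-small factors `‖f_X‖ ≤ ε^{#X}` (the genuine polymer activities `e^{−K_X} − 1`),
# over a Gaussian `N(0,Γ)` with `Γ ⪯ γ_op·1`, diagonal `≤ γ`, disjoint cells of `≤ v` sites and `κγ_op ≤ θ < 1`:
#   `|M(𝒜)| = |∫∏_{X∈𝒜}f_X dN(0,Γ)| ≤ ∏_{X∈𝒜}(ε·A^v)^{#X}`,  `A = (1−θ)^{−κγ∕(2θ)}`
# — exactly the hypothesis `hM` of (350)'s cover-counting bound (with `ε ↦ εA^v`): the polymer-local input class now runs through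
# (348) → (349) → (350) → (287) with letters read off the factors (row NE7b, node U5c; (289)∕(288) BY NAME; [folklore])

Cell `pub-balaban`, sub-cell `t4`, spine estimate NE7b (`T4WeightBudget.RelWeightBound`; the cell's OWN estimate — NOT PRINTED in
[Bałaban 1983–89], NOT PROVED).  Crux-route work under `Spine/NE7b/` by the row OWNER (`t4-ne7b-p1` gen 131, file (351)) under FREEZE
(0)'s crux-prover clause, on `g131/records/SCOPING-d5-reentry.md` (3c); NOTHING of Bałaban's is named as a Lean object, valued or asserted;
no `T4Continuum/Support` leaf typed; no `def`, no notation; zero `sorry`.  Imports (BY NAME): the OWNER's (289) `…SupRegulatedActivityBound`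
(`one_le_regulatorCost`), (288) `…SupGaussianRegulator` (`integral_exp_half_sq_on_le`, `integrable_exp_half_sq_on`), (350); the tree's
`cellActivity`.

WHAT IS PROVED ([folklore]):
* §1 `biUnion_cells_pairwiseDisjoint` (pairwise disjoint sets have pairwise disjoint cell unions), `norm_prod_le_of_letters` (pointwise:
  `‖∏_{𝒜₁∪𝒜₂}f_X(ω)‖ ≤ ε^{Σ#X}·e^{½κΣ_{x∈cells ⋃𝒜₁}ω_x²}`), `card_cells_biUnion_le` (`#cells(⋃𝒜₁) ≤ v·Σ_{X∈𝒜₁}#X`);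
* §2 THE END **`norm_setActivity_le_of_letters`** (`|M(𝒜₁ ∪ 𝒜₂)| ≤ ∏_{X}(εA^v)^{#X}`) and **`norm_setActivity_le_singletons`** (the split
  «singletons regulated, the rest sup-small» of an arbitrary family — singletons are automatically pairwise disjoint); §3 toy.

HONEST (what this is NOT).  The letter for overlapping regulated members is NOT available this way (the regulators would pile up on shared
cells) — hence the sup letter for the genuine polymers, natural for (312)'s bounded cluster terms; scalar skeleton ((A3), NC-NE7b-α UNRULED);
nothing of Bałaban's asserted.  BY-NAME EFFECT ON THE WALL: NONE.  NE7b NOT PRINTED ∕ NOT PROVED; spine PROVED 0∕9; rung (B)+1 — the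
programme's measures remain FINITE-torus statements; NOT the mass gap, NOT Clay.  HONEST DEPENDENCY: continuum YM on T⁴ ⇐ BetaPertH ∧ nine
spine estimates (0∕9 proved); BetaPertH ⇐ (D1) ∧ (D4) ∧ CAP+tail; G-an2-4 gates asym, D1 and NE2∕3∕4.
-/

set_option autoImplicit false

noncomputable section

namespace Summit.QuantumFields.BalabanUV.T4Continuum.NE7b.SupPolymerLocalActivityBound

open MeasureTheory ProbabilityTheory Finset Real
open scoped BigOperators
open Literature.Probability.LatticeModels
open SupRegulatedActivityBound (one_le_regulatorCost)
open SupGaussianRegulator (integral_exp_half_sq_on_le integrable_exp_half_sq_on)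

variable {ι : Type} [Fintype ι] [DecidableEq ι] {V : Type*} [DecidableEq V]

/-! ## §1. Pointwise letters -/

omit [Fintype ι] in
/-- Pairwise disjoint cell sets have pairwise disjoint cell unions (cells disjoint). [folklore] -/
theorem biUnion_cells_pairwiseDisjoint (cell : V → Finset ι) (hdisj : ∀ p q, p ≠ q → Disjoint (cell p) (cell q))
    {𝒜₁ : Finset (Finset V)} (hpw : ∀ X ∈ 𝒜₁, ∀ Y ∈ 𝒜₁, X ≠ Y → Disjoint X Y) :
    (𝒜₁ : Set (Finset V)).PairwiseDisjoint fun X => X.biUnion cell := by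
  intro X hX Y hY hXY
  rw [Function.onFun, disjoint_left]
  intro x hxX hxY
  obtain ⟨p, hp, hxp⟩ := mem_biUnion.1 hxX
  obtain ⟨q, hq, hxq⟩ := mem_biUnion.1 hxY
  by_cases hpq : p = q
  · subst hpq
    exact disjoint_left.1 (hpw X hX Y hY hXY) hp hq
  · exact disjoint_left.1 (hdisj p q hpq) hxp hxq

omit [Fintype ι] in
/-- **The pointwise letter of a product of factors**: regulated members on pairwise disjoint sets, sup-small members elsewhere, `ε ≥ 0` ⟹
`‖∏_{X∈𝒜₁∪𝒜₂}f_X(ω)‖ ≤ ε^{Σ_{𝒜₁∪𝒜₂}#X}·e^{½κΣ_{x∈cells ⋃𝒜₁}ω_x²}`. [folklore] -/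
theorem norm_prod_le_of_letters (cell : V → Finset ι) (hdisj : ∀ p q, p ≠ q → Disjoint (cell p) (cell q))
    {f : Finset V → EuclideanSpace ℝ ι → ℂ} {ε κ : ℝ} (hε : 0 ≤ ε) {𝒜₁ 𝒜₂ : Finset (Finset V)} (h12 : Disjoint 𝒜₁ 𝒜₂)
    (hpw : ∀ X ∈ 𝒜₁, ∀ Y ∈ 𝒜₁, X ≠ Y → Disjoint X Y)
    (hreg : ∀ X ∈ 𝒜₁, ∀ ω : EuclideanSpace ℝ ι, ‖f X ω‖ ≤ ε ^ X.card * exp (κ * (∑ x ∈ X.biUnion cell, ω x ^ 2) / 2))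
    (hsup : ∀ X ∈ 𝒜₂, ∀ ω : EuclideanSpace ℝ ι, ‖f X ω‖ ≤ ε ^ X.card) (ω : EuclideanSpace ℝ ι) :
    ‖∏ X ∈ 𝒜₁ ∪ 𝒜₂, f X ω‖ ≤
      ε ^ (∑ X ∈ 𝒜₁ ∪ 𝒜₂, X.card) * exp (κ * (∑ x ∈ (𝒜₁.biUnion id).biUnion cell, ω x ^ 2) / 2) := by
  rw [prod_union h12, norm_mul, sum_union h12, pow_add]
  have hS : ∑ x ∈ (𝒜₁.biUnion id).biUnion cell, ω x ^ 2 = ∑ X ∈ 𝒜₁, ∑ x ∈ X.biUnion cell, ω x ^ 2 := by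
    rw [Finset.biUnion_biUnion]
    simp only [id_eq]
    exact sum_biUnion (biUnion_cells_pairwiseDisjoint cell hdisj hpw)
  have h1 : ‖∏ X ∈ 𝒜₁, f X ω‖ ≤ ε ^ (∑ X ∈ 𝒜₁, X.card) * exp (κ * (∑ x ∈ (𝒜₁.biUnion id).biUnion cell, ω x ^ 2) / 2) := by
    rw [norm_prod]
    calc ∏ X ∈ 𝒜₁, ‖f X ω‖ ≤ ∏ X ∈ 𝒜₁, (ε ^ X.card * exp (κ * (∑ x ∈ X.biUnion cell, ω x ^ 2) / 2)) :=
          prod_le_prod (fun X _ => norm_nonneg _) fun X hX => hreg X hX ω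
      _ = ε ^ (∑ X ∈ 𝒜₁, X.card) * exp (κ * (∑ x ∈ (𝒜₁.biUnion id).biUnion cell, ω x ^ 2) / 2) := by
          rw [prod_mul_distrib, prod_pow_eq_pow_sum, ← Real.exp_sum, hS, mul_sum, sum_div]
  have h2 : ‖∏ X ∈ 𝒜₂, f X ω‖ ≤ ε ^ (∑ X ∈ 𝒜₂, X.card) := by
    rw [norm_prod, ← prod_pow_eq_pow_sum]
    exact prod_le_prod (fun X _ => norm_nonneg _) fun X hX => hsup X hX ω
  calc ‖∏ X ∈ 𝒜₁, f X ω‖ * ‖∏ X ∈ 𝒜₂, f X ω‖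
      ≤ (ε ^ (∑ X ∈ 𝒜₁, X.card) * exp (κ * (∑ x ∈ (𝒜₁.biUnion id).biUnion cell, ω x ^ 2) / 2)) * ε ^ (∑ X ∈ 𝒜₂, X.card) :=
        mul_le_mul h1 h2 (norm_nonneg _) (by positivity)
    _ = ε ^ (∑ X ∈ 𝒜₁, X.card) * ε ^ (∑ X ∈ 𝒜₂, X.card) * exp (κ * (∑ x ∈ (𝒜₁.biUnion id).biUnion cell, ω x ^ 2) / 2) := by ring

omit [Fintype ι] in
/-- `#cells(⋃𝒜₁) ≤ v·Σ_{X∈𝒜₁}#X`. [folklore] -/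
theorem card_cells_biUnion_le (cell : V → Finset ι) {v : ℕ} (hv : ∀ p, (cell p).card ≤ v) (𝒜₁ : Finset (Finset V)) :
    ((𝒜₁.biUnion id).biUnion cell).card ≤ v * ∑ X ∈ 𝒜₁, X.card := by
  calc ((𝒜₁.biUnion id).biUnion cell).card ≤ ∑ p ∈ 𝒜₁.biUnion id, (cell p).card := card_biUnion_le
    _ ≤ ∑ p ∈ 𝒜₁.biUnion id, v := sum_le_sum fun p _ => hv p
    _ = v * (𝒜₁.biUnion id).card := by rw [sum_const, smul_eq_mul, mul_comm]
    _ ≤ v * ∑ X ∈ 𝒜₁, X.card := Nat.mul_le_mul_left v card_biUnion_le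

/-! ## §2. THE END: the activity letter -/

/-- **THE ACTIVITY LETTER FROM FACTOR LETTERS.**  `Γ ⪰ 0`, `Γ ⪯ γ_op·1`, diagonal `≤ γ` (`γ ≥ 0`); disjoint cells of `≤ v` sites;
`0 ≤ ε`, `0 ≤ κ`, `0 < θ < 1`, `κγ_op ≤ θ`; `𝒜₁, 𝒜₂` disjoint families, the members of `𝒜₁` pairwise disjoint with regulated factors, those of
`𝒜₂` with sup-small factors, all factors measurable ⟹ `‖M(𝒜₁ ∪ 𝒜₂)‖ ≤ ∏_{X∈𝒜₁∪𝒜₂}(ε·A^v)^{#X}`, `A = (1−θ)^{−κγ∕(2θ)}`. [folklore] -/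
theorem norm_setActivity_le_of_letters {Γ : Matrix ι ι ℝ} {γop γ : ℝ} (hΓ : Γ.PosSemidef)
    (hΓop : (γop • (1 : Matrix ι ι ℝ) - Γ).PosSemidef) (hdiag : ∀ i, Γ i i ≤ γ) (hγ : 0 ≤ γ) (cell : V → Finset ι)
    (hdisj : ∀ p q, p ≠ q → Disjoint (cell p) (cell q)) {v : ℕ} (hv : ∀ p, (cell p).card ≤ v)
    {f : Finset V → EuclideanSpace ℝ ι → ℂ} {ε κ θ : ℝ} (hε : 0 ≤ ε) (hκ : 0 ≤ κ) (hθ0 : 0 < θ) (hθ1 : θ < 1) (hκθ : κ * γop ≤ θ)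
    {𝒜₁ 𝒜₂ : Finset (Finset V)} (h12 : Disjoint 𝒜₁ 𝒜₂) (hpw : ∀ X ∈ 𝒜₁, ∀ Y ∈ 𝒜₁, X ≠ Y → Disjoint X Y)
    (hreg : ∀ X ∈ 𝒜₁, ∀ ω : EuclideanSpace ℝ ι, ‖f X ω‖ ≤ ε ^ X.card * exp (κ * (∑ x ∈ X.biUnion cell, ω x ^ 2) / 2))
    (hsup : ∀ X ∈ 𝒜₂, ∀ ω : EuclideanSpace ℝ ι, ‖f X ω‖ ≤ ε ^ X.card) :
    ‖cellActivity (multivariateGaussian 0 Γ) f (𝒜₁ ∪ 𝒜₂)‖ ≤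
      ∏ X ∈ 𝒜₁ ∪ 𝒜₂, (ε * ((1 - θ) ^ (-(κ * γ / (2 * θ)))) ^ v) ^ X.card := by
  set μ := multivariateGaussian 0 Γ with hμ
  set A : ℝ := (1 - θ) ^ (-(κ * γ / (2 * θ))) with hA
  set U := (𝒜₁.biUnion id).biUnion cell with hU
  set N := ∑ X ∈ 𝒜₁ ∪ 𝒜₂, X.card with hN
  have hA1 : 1 ≤ A := one_le_regulatorCost (mul_nonneg hκ hγ) hθ0 hθ1
  have hint := integrable_exp_half_sq_on hΓ hΓop hκ hθ1 hκθ U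
  have hgauss := integral_exp_half_sq_on_le hΓ hΓop hκ hθ0 hθ1 hκθ U fun i _ => hdiag i
  have hUN : U.card ≤ v * N := by
    refine (card_cells_biUnion_le cell hv 𝒜₁).trans (Nat.mul_le_mul_left v ?_)
    rw [hN, sum_union h12]
    exact Nat.le_add_right _ _
  unfold cellActivity
  calc ‖∫ ω, ∏ X ∈ 𝒜₁ ∪ 𝒜₂, f X ω ∂μ‖ ≤ ∫ ω, ‖∏ X ∈ 𝒜₁ ∪ 𝒜₂, f X ω‖ ∂μ := norm_integral_le_integral_norm _
    _ ≤ ∫ ω, ε ^ N * exp (κ * (∑ x ∈ U, ω x ^ 2) / 2) ∂μ :=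
        integral_mono_of_nonneg (ae_of_all _ fun _ => norm_nonneg _) (hint.const_mul _)
          (ae_of_all _ fun ω => norm_prod_le_of_letters cell hdisj hε h12 hpw hreg hsup ω)
    _ = ε ^ N * ∫ ω, exp (κ * (∑ x ∈ U, ω x ^ 2) / 2) ∂μ := integral_const_mul _ _
    _ ≤ ε ^ N * A ^ U.card := mul_le_mul_of_nonneg_left hgauss (pow_nonneg hε _)
    _ ≤ ε ^ N * A ^ (v * N) := mul_le_mul_of_nonneg_left (pow_le_pow_right₀ hA1 hUN) (pow_nonneg hε _)
    _ = (ε * A ^ v) ^ N := by rw [mul_pow, ← pow_mul]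
    _ = ∏ X ∈ 𝒜₁ ∪ 𝒜₂, (ε * A ^ v) ^ X.card := by rw [hN, prod_pow_eq_pow_sum]

/-- **THE SPLIT «SINGLETONS REGULATED, THE REST SUP-SMALL»**: for ANY finite family `𝒜` of cell sets whose singletons carry regulated factors
and whose other members carry sup-small factors, `‖M(𝒜)‖ ≤ ∏_{X∈𝒜}(ε·A^v)^{#X}` (distinct singletons are disjoint). [folklore] -/
theorem norm_setActivity_le_singletons {Γ : Matrix ι ι ℝ} {γop γ : ℝ} (hΓ : Γ.PosSemidef)
    (hΓop : (γop • (1 : Matrix ι ι ℝ) - Γ).PosSemidef) (hdiag : ∀ i, Γ i i ≤ γ) (hγ : 0 ≤ γ) (cell : V → Finset ι)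
    (hdisj : ∀ p q, p ≠ q → Disjoint (cell p) (cell q)) {v : ℕ} (hv : ∀ p, (cell p).card ≤ v)
    {f : Finset V → EuclideanSpace ℝ ι → ℂ} {ε κ θ : ℝ} (hε : 0 ≤ ε) (hκ : 0 ≤ κ) (hθ0 : 0 < θ) (hθ1 : θ < 1) (hκθ : κ * γop ≤ θ)
    (hreg : ∀ X : Finset V, X.card = 1 → ∀ ω : EuclideanSpace ℝ ι, ‖f X ω‖ ≤ ε ^ X.card * exp (κ * (∑ x ∈ X.biUnion cell, ω x ^ 2) / 2))
    (hsup : ∀ X : Finset V, X.card ≠ 1 → ∀ ω : EuclideanSpace ℝ ι, ‖f X ω‖ ≤ ε ^ X.card) (𝒜 : Finset (Finset V)) :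
    ‖cellActivity (multivariateGaussian 0 Γ) f 𝒜‖ ≤ ∏ X ∈ 𝒜, (ε * ((1 - θ) ^ (-(κ * γ / (2 * θ)))) ^ v) ^ X.card := by
  have hsplit : 𝒜.filter (fun X => X.card = 1) ∪ 𝒜.filter (fun X => ¬ X.card = 1) = 𝒜 := filter_union_filter_not_eq _ 𝒜
  have h12 : Disjoint (𝒜.filter (fun X => X.card = 1)) (𝒜.filter (fun X => ¬ X.card = 1)) := disjoint_filter_filter_not 𝒜 𝒜 _
  have hpw : ∀ X ∈ 𝒜.filter (fun X => X.card = 1), ∀ Y ∈ 𝒜.filter (fun X => X.card = 1), X ≠ Y → Disjoint X Y := by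
    intro X hX Y hY hXY
    obtain ⟨a, rfl⟩ := card_eq_one.1 (mem_filter.1 hX).2
    obtain ⟨b, rfl⟩ := card_eq_one.1 (mem_filter.1 hY).2
    rw [disjoint_singleton_left, mem_singleton]
    exact fun hab => hXY (by rw [hab])
  have key := norm_setActivity_le_of_letters hΓ hΓop hdiag hγ cell hdisj hv hε hκ hθ0 hθ1 hκθ h12 hpw
    (fun X hX => hreg X (mem_filter.1 hX).2) (fun X hX => hsup X (mem_filter.1 hX).2) (f := f)
  rwa [hsplit] at key

/-! ## §3. Toy -/

/-- Toy (§1): the cells of the union of the EMPTY family number `0 ≤ v·0`. -/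
example (cell : Fin 2 → Finset (Fin 4)) : (((∅ : Finset (Finset (Fin 2))).biUnion id).biUnion cell).card ≤ 4 * ∑ X ∈ (∅ : Finset (Finset (Fin 2))), X.card :=
  card_cells_biUnion_le cell (v := 4) (fun p => (card_le_univ _).trans (by simp)) ∅

end Summit.QuantumFields.BalabanUV.T4Continuum.NE7b.SupPolymerLocalActivityBound
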